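import Literature.NumberTheory.QuadraticFields.ThreeTorsion
import Mathlib.Algebra.Module.ZMod
import Mathlib.Algebra.Field.ZMod
import Mathlib.LinearAlgebra.Projectivization.Cardinality
import Mathlib.LinearAlgebra.Dual.Lemmas
import Mathlib.FieldTheory.Finiteness
import Mathlib.GroupTheory.Index
import Mathlib.GroupTheory.OrderOfElement
import Mathlib.GroupTheory.QuotientGroup.Basic
import HarnessLib

/-!
# `#Cl(K)[3] = 2·#{index-3 subgroups of Cl(K)} + 1`: the group half of the cubic-field dictionary (proofs)

A `…Proofs` companion (theorems only: no definition, no named fact, no instance; D-0026) of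
`Literature.NumberTheory.QuadraticFields.ThreeTorsion` (`quadFieldThreeTorsion D = #Cl(𝓞_K)[3]`).

The arithmetic-statistics literature passes between the 3-torsion statistic `#Cl(ℚ(√D))[3]`
and counts of cubic fields through the dictionary "`#Cl₃(D) = 2·#{cubic fields of discriminant D} + 1`"
(Hasse 1930; Bhargava–Shankar–Tsimerman §8.5; Bhargava–Taniguchi–Thorne 2023, p. 3: "as
subgroups of `Cl(ℚ(√D))` of index `3` are in bijection with cubic fields of discriminant `D` …,
Theorem 1.2 is equivalent to" the count `N^±_{3,fund}(X)` of cubic fields of fundamental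
discriminant). That dictionary has two halves:

* class field theory: index-`3` subgroups of `Cl(K)` ↔ unramified cyclic cubic extensions of the
  quadratic field `K` ↔ (non-Galois) cubic fields of discriminant `d_K` — NOT here (no class
  field theory in Mathlib);
* finite abelian groups: `2·#{H ≤ G : [G : H] = 3} + 1 = #{g ∈ G : g³ = 1}` — PROVED here, for
  every prime `p` in the form `(p − 1)·#{H ≤ A : [A : H] = p} + 1 = #A[p]`
  (`card_addSubgroup_index_eq_mul_add_one`, multiplicative `two_mul_card_subgroup_index_three_add_one`),
  and specialised to the tree's statistic:
  `quadFieldThreeTorsion_eq_two_mul_card_index_three_add_one :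
    quadFieldThreeTorsion D = 2·#{H ≤ Cl(𝓞_K) : [Cl(𝓞_K) : H] = 3} + 1`
  for every quadratic field `K` of discriminant `D`.

Proof of the group-theoretic half: `A/pA` and `A[p]` have the same order (`x ↦ p·x` has kernel
`A[p]` and image `pA`); subgroups of index `p` contain `pA`, so they are the index-`p` subgroups of
the `𝔽_p`-vector space `V = A/pA`, i.e. its hyperplanes; hyperplanes of `V` are the lines of the
dual space (`W ↦ W.dualAnnihilator`), and `#V* = #ℙ(V*)·(p − 1) + 1` (`Projectivization.card'`)
with `#V* = #V`.

## References

* H. Hasse, *Arithmetische Theorie der kubischen Zahlkörper auf klassenkörpertheoretischer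
  Grundlage*, Math. Z. 31 (1930) 565–582 [Hasse1930].
* M. Bhargava, A. Shankar, J. Tsimerman, *On the Davenport–Heilbronn theorems and second order
  terms*, Invent. Math. 193 (2013), §8.5 [BhargavaShankarTsimerman2012].
* M. Bhargava, T. Taniguchi, F. Thorne, *Improved error estimates for the Davenport–Heilbronn
  theorems*, Math. Ann. 389 (2024) = arXiv:2107.12819, p. 3 [BhargavaTaniguchiThorne2023].

## Mathlib search

`Subgroup.pow_index_mem` / `AddSubgroup.nsmul_index_mem`, `Subgroup.index_comap_of_surjective`,
`Subgroup.comap_map_eq`, `QuotientGroup.quotientKerEquivRange`, `Subgroup.card_mul_index`,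
`QuotientAddGroup.zmodModule`, `AddSubgroup.toZModSubmodule`, `Module.natCard_eq_pow_finrank`,
`Subspace.finrank_add_finrank_dualAnnihilator_eq`, `Subspace.dualAnnihilator_dualCoannihilator_eq`,
`Projectivization.equivSubmodule`, `Projectivization.card'`, `Subgroup.toAddSubgroup`,
`Subgroup.index_toAddSubgroup`.
-/

open Module NumberField

namespace Literature.NumberTheory.QuadraticFields

/-! ### Hyperplanes of a finite vector space -/

/-- **Counting hyperplanes.** For a finite-dimensional vector space `V` over a finite field `K`
with `q` elements, `#{W ≤ V : dim(V/W) = 1}·(q − 1) + 1 = #V`: hyperplanes of `V` are the lines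
of the dual space `V*` (`W ↦ W⁰`, inverse `L ↦ L₀`), and `#V* = #ℙ(V*)·(q − 1) + 1` with
`#V* = q^{dim V} = #V`. [folklore] -/
theorem card_hyperplanes_mul_add_one {K V : Type*} [Field K] [Finite K] [AddCommGroup V]
    [Module K V] [FiniteDimensional K V] :
    Nat.card {W : Submodule K V // finrank K (V ⧸ W) = 1} * (Nat.card K - 1) + 1 = Nat.card V := by
  haveI : Finite (Module.Dual K V) := Module.finite_of_finite K
  haveI : Finite V := Module.finite_of_finite K
  -- hyperplanes ↔ lines in the dual
  let e : {W : Submodule K V // finrank K (V ⧸ W) = 1} ≃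
      {L : Submodule K (Module.Dual K V) // finrank K L = 1} :=
    { toFun := fun W => ⟨W.1.dualAnnihilator, by
        have h1 := Subspace.finrank_add_finrank_dualAnnihilator_eq W.1
        have h2 := W.1.finrank_quotient_add_finrank
        have h3 := W.2
        omega⟩
      invFun := fun L => ⟨L.1.dualCoannihilator, by
        have h1 := Subspace.finrank_add_finrank_dualCoannihilator_eq L.1
        have h2 := L.1.dualCoannihilator.finrank_quotient_add_finrank
        have h3 := L.2
        omega⟩
      left_inv := fun W => Subtype.ext Subspace.dualAnnihilator_dualCoannihilator_eq
      right_inv := fun L => Subtype.ext Subspace.dualCoannihilator_dualAnnihilator_eq }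
  rw [Nat.card_congr (e.trans (Projectivization.equivSubmodule K (Module.Dual K V)).symm),
    ← Projectivization.card' K (Module.Dual K V), Module.natCard_eq_pow_finrank (K := K),
    Module.natCard_eq_pow_finrank (K := K) (V := V), Subspace.dual_finrank_eq]

/-! ### Index-`p` subgroups versus `p`-torsion in a finite abelian group -/

/-- **`(p − 1)·#{H ≤ A : [A : H] = p} + 1 = #A[p]`** for a finite abelian group `A` (written
additively) and a prime `p`. Proof: `#A[p] = #(A/pA)` (kernel and image of `x ↦ p·x`); a subgroup
of index `p` contains `pA` (`AddSubgroup.nsmul_index_mem`), so index-`p` subgroups of `A` are the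
index-`p` subgroups of the `𝔽_p`-vector space `A/pA`, i.e. its hyperplanes, counted by
`card_hyperplanes_mul_add_one`. [folklore] -/
theorem card_addSubgroup_index_eq_mul_add_one {A : Type*} [AddCommGroup A] [Finite A] {p : ℕ}
    [hp : Fact p.Prime] :
    (p - 1) * Nat.card {H : AddSubgroup A // H.index = p} + 1 = Nat.card {a : A // p • a = 0} := by
  set f : A →+ A := nsmulAddMonoidHom p with hf
  set N : AddSubgroup A := f.range with hN
  -- (1) `#A[p] = #(A ⧸ pA)`
  have hker : Nat.card {a : A // p • a = 0} = Nat.card f.ker :=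
    Nat.card_congr (Equiv.subtypeEquivRight fun a => by rw [AddMonoidHom.mem_ker]; rfl)
  have hcardQ : Nat.card {a : A // p • a = 0} = Nat.card (A ⧸ N) := by
    rw [hker]
    have h1 := f.ker.card_mul_index
    have h2 := N.card_mul_index
    rw [AddSubgroup.index_eq_card,
      Nat.card_congr (QuotientAddGroup.quotientKerEquivRange f).toEquiv] at h1
    rw [AddSubgroup.index_eq_card] at h2
    have hpos : 0 < Nat.card N := Nat.card_pos
    rw [← h2, mul_comm] at h1
    exact Nat.eq_of_mul_eq_mul_left hpos h1
  -- (2) index-`p` subgroups of `A` ↔ index-`p` subgroups of `Q = A ⧸ pA`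
  have hNp : ∀ x : A, p • x ∈ N := fun x => ⟨x, rfl⟩
  have hle : ∀ H : AddSubgroup A, H.index = p → N ≤ H := by
    rintro H hH _ ⟨x, rfl⟩
    have := H.nsmul_index_mem x
    rwa [hH] at this
  set π := QuotientAddGroup.mk' N with hπ
  have hπs : Function.Surjective π := QuotientAddGroup.mk'_surjective N
  let e1 : {H : AddSubgroup A // H.index = p} ≃ {H' : AddSubgroup (A ⧸ N) // H'.index = p} :=
    { toFun := fun H => ⟨H.1.map π, by
        rw [← AddSubgroup.index_comap_of_surjective _ hπs, AddSubgroup.comap_map_eq,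
          QuotientAddGroup.ker_mk', sup_eq_left.mpr (hle H.1 H.2)]
        exact H.2⟩
      invFun := fun H' => ⟨H'.1.comap π, by
        rw [AddSubgroup.index_comap_of_surjective _ hπs]; exact H'.2⟩
      left_inv := fun H => Subtype.ext (by
        simp only
        rw [AddSubgroup.comap_map_eq, QuotientAddGroup.ker_mk', sup_eq_left.mpr (hle H.1 H.2)])
      right_inv := fun H' => Subtype.ext (by
        simp only
        rw [AddSubgroup.map_comap_eq_self_of_surjective hπs]) }
  -- (3) `Q` is an `𝔽_p`-vector space; its index-`p` subgroups are its hyperplanes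
  -- (`haveI`, not `letI`: the `match p` inside `AddCommGroup.zmodModule` must stay opaque, or
  -- instance unification for quotients of `Submodule (ZMod p) _` gets stuck for a variable `p`)
  haveI : Module (ZMod p) (A ⧸ N) := QuotientAddGroup.zmodModule hNp
  haveI : Module.Finite (ZMod p) (A ⧸ N) := Module.Finite.of_finite
  let e2 : {H' : AddSubgroup (A ⧸ N) // H'.index = p} ≃
      {W : Submodule (ZMod p) (A ⧸ N) // finrank (ZMod p) ((A ⧸ N) ⧸ W) = 1} :=
    (AddSubgroup.toZModSubmodule p).toEquiv.subtypeEquiv fun H' => by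
      change H'.index = p ↔ finrank (ZMod p) ((A ⧸ N) ⧸ AddSubgroup.toZModSubmodule p H') = 1
      have hq : Nat.card ((A ⧸ N) ⧸ AddSubgroup.toZModSubmodule p H') = H'.index := by
        rw [AddSubgroup.index_eq_card]
        rfl
      rw [← hq, Module.natCard_eq_pow_finrank (K := ZMod p), Nat.card_zmod]
      constructor
      · intro h
        exact Nat.pow_right_injective hp.out.two_le (by simpa using h)
      · intro h
        rw [h, pow_one]
  rw [Nat.card_congr (e1.trans e2), hcardQ]
  have key : Nat.card {W : Submodule (ZMod p) (A ⧸ N) // finrank (ZMod p) ((A ⧸ N) ⧸ W) = 1}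
      * (p - 1) + 1 = Nat.card (A ⧸ N) := by
    have := card_hyperplanes_mul_add_one (K := ZMod p) (V := A ⧸ N)
    rwa [Nat.card_zmod] at this
  rw [← key, mul_comm]

/-- **`2·#{H ≤ G : [G : H] = 3} + 1 = #{g ∈ G : g³ = 1}`** for a finite abelian group `G`
(multiplicative form of `card_addSubgroup_index_eq_mul_add_one` at `p = 3`, transported along
`Additive G`). This is the finite-group half of the dictionary
`#Cl₃(D) = 2·#{cubic fields of discriminant D} + 1` (BST §8.5; BTT 2023 p. 3), whose other half
— index-`3` subgroups of `Cl(ℚ(√D))` ↔ cubic fields of discriminant `D` — is class field theory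
(Hasse 1930). [folklore] -/
theorem two_mul_card_subgroup_index_three_add_one {G : Type*} [CommGroup G] [Finite G] :
    2 * Nat.card {H : Subgroup G // H.index = 3} + 1 = Nat.card {g : G // g ^ 3 = 1} := by
  haveI : Fact (Nat.Prime 3) := ⟨Nat.prime_three⟩
  have h := card_addSubgroup_index_eq_mul_add_one (A := Additive G) (p := 3)
  have e1 : {H : Subgroup G // H.index = 3} ≃ {H : AddSubgroup (Additive G) // H.index = 3} :=
    Subgroup.toAddSubgroup.toEquiv.subtypeEquiv fun H => by
      change H.index = 3 ↔ (Subgroup.toAddSubgroup H).index = 3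
      rw [Subgroup.index_toAddSubgroup]
  have e2 : {g : G // g ^ 3 = 1} ≃ {a : Additive G // 3 • a = 0} :=
    Additive.ofMul.subtypeEquiv fun _ => Iff.rfl
  rw [Nat.card_congr e1, Nat.card_congr e2]
  exact h

/-! ### The statistic `#Cl₃(D)` as a count of index-`3` subgroups -/

/-- **`#Cl₃(D) = 2·#{H ≤ Cl(𝓞_K) : [Cl(𝓞_K) : H] = 3} + 1`** for every quadratic field `K` of
discriminant `D`: the tree's statistic `quadFieldThreeTorsion D = #Cl(𝓞_K)[3]`
(`quadFieldThreeTorsion_eq`) counted through index-`3` subgroups of the class group. Composed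
with the class-field-theoretic bijection "index-`3` subgroups of `Cl(ℚ(√D))` ↔ cubic fields of
discriminant `D`" (Hasse; BST §8.5; not in the tree) this is the identity
`Σ_D #Cl₃(D) = N₂^±(X) + 2 N^±_{3,fund}(X)` by which Bhargava–Taniguchi–Thorne, p. 3, pass
between their Thm 1.2 (`btt_threeTorsion_sum`) and the count of cubic fields of fundamental
discriminant. [cite: BhargavaTaniguchiThorne2023, p. 3 (equivalence of Thm 1.2 with (3))] -/
theorem quadFieldThreeTorsion_eq_two_mul_card_index_three_add_one (D : ℤ) (K : Type*) [Field K]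
    [NumberField K] (h2 : Module.finrank ℚ K = 2) (hD : NumberField.discr K = D) :
    quadFieldThreeTorsion D =
      2 * Nat.card {H : Subgroup (ClassGroup (𝓞 K)) // H.index = 3} + 1 := by
  rw [quadFieldThreeTorsion_eq D K h2 hD, two_mul_card_subgroup_index_three_add_one]

/-- In particular `#Cl₃(D)` is odd and `(#Cl₃(D) − 1)/2` is the number of index-`3` subgroups of
the class group of the quadratic field of discriminant `D`. [folklore] -/
theorem card_index_three_eq_quadFieldThreeTorsion_sub_one_div_two (D : ℤ) (K : Type*) [Field K]
    [NumberField K] (h2 : Module.finrank ℚ K = 2) (hD : NumberField.discr K = D) :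
    Nat.card {H : Subgroup (ClassGroup (𝓞 K)) // H.index = 3} = (quadFieldThreeTorsion D - 1) / 2 := by
  rw [quadFieldThreeTorsion_eq_two_mul_card_index_three_add_one D K h2 hD]
  omega

end Literature.NumberTheory.QuadraticFields
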